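/-
Copyright: the b2b-balaban cell (near-miss cell 7), T⁴-continuum fan-out; row NE7b ROUND-2 swarm, seat
t4-ne7b-formalise-leaf-10 (row S6g′(d) of `t4/b2b-balaban-t4-ne7b-p1/LEAVES-NE7b.md`, owner's ruling R-OWNER-22-12 (2)).
Released under the licence of the surrounding project.
-/
import Summits.QuantumFields.BalabanUV.T4Continuum.Support.CrowdingAnalysis

/-!
# Sibling mass: the SYMMETRISED crowding cost is class-linear at exponent ONE (row S6g′(d), arithmetic core)

Summits-side support leaf of the T⁴-continuum cell (rung (B)+1 on a FINITE torus only; NOT infinite volume, NOT the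
mass gap, NOT the Clay statement; NOT a proof of the spine estimate NE7b).  Row NE7b, route «COUNT»; the owner's
re-specified row S6g′ «MASS-BASED SIBLING COUNT» (R-OWNER-22-12 (2), on this seat's finding F-leaf10-1): its step (d),
the class-linear inequality, as a TREE-FREE kernel lemma over per-step data.  [folklore] real arithmetic and finite
sums; nothing is quoted from print, nothing printed is asserted, no `[cite:]` tag, no `Prop` fact minted; constants
explicit and symbolic.

THE STATEMENT (per step, `step_cost_le`).  At one step let the mergers be grouped into finitely many SIBLING GROUPS `g`
(interchangeable partners — equal tagged shape), of sizes `k_g ≥ 1` and ranks `r_g ≥ 0` (in the chain: age + class of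
the group's younger root), let `n ≥ Σ_g k_g`, `n > 0` be the weighted formation count of the step and `Q ≥ n` the
discounted crowding (`CrowdingAnalysis.Q`, the step's count plus the decayed past).  If every merger costs `log Q`
(the MASS-based placement factor of S6g′(b): exponent ONE, not the ball's `d`) and every group is credited its
symmetry factor `log k_g!` (S6g′(c)), then for every rate `c ≥ 0`

  `Σ_g (k_g·log Q − log k_g!) ≤ (Q − n) + Σ_g k_g + c·Σ_g k_g·r_g + n·Σ_g e^{−c·r_g}`.

Proof, three lines: `log k! ≥ k log k − k` (`klogk_sub_le_log_factorial`), so the group costs `≤ k log(Q∕k) + k =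
k log(Q∕n) + k log(n∕k) + k`; `Σ_g k_g log(Q∕n) ≤ n log(Q∕n) ≤ Q − n`; and `k log(n∕k) = k log(n e^{−cr}∕k) + ckr ≤
n e^{−cr} − k + ckr` (`log y ≤ y − 1`).  NO square-root machinery, NO genericity.  `sum_exp_neg_rank_le`: if the groups
of each rank `ρ` number at most `ρ + 1` (in the chain: distinct groups at one step have distinct (age, class) pairs, and
`ρ + 1` pairs have `age + class = ρ`), then `Σ_g e^{−c r_g} ≤ 1∕(1 − e^{−c})²`.  Summed over the steps
(`total_cost_le`, `Q_t = Q n σ t`, `Σ_t Q_t ≤ Σ_t n_t∕(1−σ²)` by `sum_Q_le`):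

  `Σ_t Σ_g (k·log Q_t − log k!) ≤ (1∕(1−σ²) + 1∕(1−e^{−c})²)·Σ_t n_t + c·Σ_t Σ_g k·r`

— CLASS-LINEAR: in the chain `Σ_t n_t ≤ F + #merges` and `Σ k·r = partnerAges + (classes of younger roots) ≤
partnerAges + F` (`CrowdingRoots.youngerRoot_injOn`), so with `c := min θ ε` this is the budget shape
`θ·F + ε·partnerAges + A·(F + #merges)` of `Crowding.crowding` ∕ `crowdingW`, WITHOUT `BirthShapeNodup`.

WHAT THIS SETTLES AND WHAT NOT (located).  (i) Exponent ONE is necessary: at exponent `p` the uncredited surplus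
`(p−1)·Σ_e log Q` is `(p−1)(m−1)log m` on a crowd of `m` equal siblings (F-leaf10-1; the ball count has `p = d`).
(ii) The symmetry credit `log k_g!` is legitimate for groups of INTERCHANGEABLE partners (equal tagged SHAPE of the
partner subtree) — for bare-birth siblings «equal shape» = «equal (step, class)» = «equal rank at that step», so the
rank-fibre hypothesis holds with `ρ + 1`; COMPOSITE partners with equal younger-root pair but different subtrees are
distinct groups of one rank — then the fibre bound is a DISPLAYED hypothesis on the data (the residual «equal-root
composite partners at one step», strictly inside R-OWNER-22-9's `BirthShapeNodup` complement; print pays it through the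
HOST's per-volume entropy «exp O(1)(MR_j)^{−d}|Z_j|», B16 p. 383 — CONTEXT, not asserted — i.e. by summing partner
TYPES against the host mass, a generating-function step beyond a per-genealogy count).  (iii) Rows S6g′(a)(b)(c) (the
cardinality law of the reading, the mass-based placement count, the canonical sibling order) are NOT here.

HONEST DEPENDENCY (cell): continuum YM on T⁴ ⇐ BetaPertH ∧ nine spine estimates (0/9 proved); BetaPertH ⇐ (D1) ∧ (D4)
∧ CAP+tail.  This file changes none of it.  NE7b NOT proved.
-/

open Finset
open Summit.QuantumFields.BalabanUV.T4Continuum.Crowding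

namespace Summit.QuantumFields.BalabanUV.T4Continuum.HistorySiblingMass

noncomputable section

/-! ## §1 Two elementary inequalities -/

/-- **`k log k − k ≤ log k!`** (the half of Stirling the symmetry credit needs; by induction with `log(1 + 1∕k) ≤ 1∕k`).
[folklore] -/
theorem klogk_sub_le_log_factorial : ∀ k : ℕ, (k : ℝ) * Real.log k - k ≤ Real.log (Nat.factorial k : ℝ)
  | 0 => by simp
  | k + 1 => by
      have ih := klogk_sub_le_log_factorial k
      have hk1 : (0 : ℝ) < (k : ℝ) + 1 := by positivity
      rw [Nat.factorial_succ, Nat.cast_mul, Real.log_mul (by positivity) (by positivity)]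
      push_cast
      -- `k·(log(k+1) − log k) ≤ 1`, i.e. `k·log((k+1)/k) ≤ (k+1) − k`
      rcases Nat.eq_zero_or_pos k with hk | hk
      · subst hk; simp
      · have hk0 : (0 : ℝ) < k := by exact_mod_cast hk
        have hlog : Real.log (((k : ℝ) + 1) / k) ≤ ((k : ℝ) + 1) / k - 1 := Real.log_le_sub_one_of_pos (by positivity)
        rw [Real.log_div hk1.ne' hk0.ne'] at hlog
        have h1 : (k : ℝ) * (Real.log ((k : ℝ) + 1) - Real.log k) ≤ 1 := by
          calc (k : ℝ) * (Real.log ((k : ℝ) + 1) - Real.log k) ≤ k * (((k : ℝ) + 1) / k - 1) :=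
                mul_le_mul_of_nonneg_left hlog hk0.le
            _ = 1 := by field_simp; ring
        nlinarith [h1, ih]

/-- `k·log(x∕k) ≤ x − k` for `k, x > 0` (`log y ≤ y − 1`). [folklore] -/
theorem mul_log_div_le {k x : ℝ} (hk : 0 < k) (hx : 0 < x) : k * Real.log (x / k) ≤ x - k := by
  have h := Real.log_le_sub_one_of_pos (div_pos hx hk)
  calc k * Real.log (x / k) ≤ k * (x / k - 1) := mul_le_mul_of_nonneg_left h hk.le
    _ = x - k := by field_simp

/-- **ONE SIBLING GROUP.**  Size `k ≥ 1`, rank `r`, step count `n ≥ k`, crowding `Q ≥ n`, any rate `c`: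
`k·log Q − log k! ≤ k·log(Q∕n) + k + c·k·r + n·e^{−c·r}`. [folklore] -/
theorem group_cost_le {k : ℕ} (hk : 1 ≤ k) {n Q : ℝ} (c r : ℝ) (hn : (k : ℝ) ≤ n) (hQ : n ≤ Q) :
    (k : ℝ) * Real.log Q - Real.log (Nat.factorial k : ℝ) ≤
      (k : ℝ) * Real.log (Q / n) + k + c * k * r + n * Real.exp (-(c * r)) := by
  have hk0 : (0 : ℝ) < k := by exact_mod_cast hk
  have hn0 : 0 < n := hk0.trans_le hn
  have hQ0 : 0 < Q := hn0.trans_le hQ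
  have hfact := klogk_sub_le_log_factorial k
  -- `k log Q − (k log k − k) = k log(Q/n) + k log(n/k) + k`
  have hsplit : (k : ℝ) * Real.log Q - ((k : ℝ) * Real.log k - k) =
      (k : ℝ) * Real.log (Q / n) + (k : ℝ) * Real.log (n / k) + k := by
    rw [Real.log_div hQ0.ne' hn0.ne', Real.log_div hn0.ne' hk0.ne']; ring
  -- `k log(n/k) = k log((n e^{−cr})/k) + c k r ≤ n e^{−cr} − k + c k r`
  have hx0 : 0 < n * Real.exp (-(c * r)) := mul_pos hn0 (Real.exp_pos _)
  have hrest : (k : ℝ) * Real.log (n / k) ≤ n * Real.exp (-(c * r)) - k + c * k * r := by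
    have h1 := mul_log_div_le hk0 hx0
    have h2 : Real.log (n * Real.exp (-(c * r)) / k) = Real.log (n / k) - c * r := by
      rw [mul_div_right_comm, Real.log_mul (div_pos hn0 hk0).ne' (Real.exp_pos _).ne', Real.log_exp]; ring
    rw [h2] at h1
    nlinarith [h1]
  linarith [hfact, hsplit, hrest]

/-! ## §2 One step: all sibling groups against the step's crowding -/

/-- **ONE STEP, SYMMETRISED (exponent one).**  Groups `g ∈ Gs` of sizes `k g ≥ 1` and ranks `r g ≥ 0`, weighted step
count `n ≥ Σ_g k g`, `n > 0`, crowding `Q ≥ n`, any rate `c`: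
`Σ_g (k·log Q − log k!) ≤ (Q − n) + Σ_g k + c·Σ_g k·r + n·Σ_g e^{−c·r}`. [folklore] -/
theorem step_cost_le {β : Type*} (Gs : Finset β) (k : β → ℕ) (r : β → ℝ) {n Q : ℝ} (c : ℝ)
    (hk : ∀ g ∈ Gs, 1 ≤ k g) (hn : (∑ g ∈ Gs, (k g : ℝ)) ≤ n) (hn0 : 0 < n) (hQ : n ≤ Q) :
    ∑ g ∈ Gs, ((k g : ℝ) * Real.log Q - Real.log (Nat.factorial (k g) : ℝ)) ≤
      (Q - n) + ∑ g ∈ Gs, (k g : ℝ) + c * ∑ g ∈ Gs, (k g : ℝ) * r g + n * ∑ g ∈ Gs, Real.exp (-(c * r g)) := by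
  -- group by group
  have h1 : ∑ g ∈ Gs, ((k g : ℝ) * Real.log Q - Real.log (Nat.factorial (k g) : ℝ)) ≤
      ∑ g ∈ Gs, ((k g : ℝ) * Real.log (Q / n) + k g + c * k g * r g + n * Real.exp (-(c * r g))) :=
    sum_le_sum fun g hg =>
      group_cost_le (hk g hg) c (r g) ((single_le_sum (fun _ _ => Nat.cast_nonneg _) hg).trans hn) hQ
  -- the common factor `log(Q/n) ≥ 0`: `(Σ k) log(Q/n) ≤ n log(Q/n) ≤ Q − n`
  have hlog0 : 0 ≤ Real.log (Q / n) := Real.log_nonneg ((one_le_div hn0).2 hQ)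
  have h2 : ∑ g ∈ Gs, (k g : ℝ) * Real.log (Q / n) ≤ Q - n := by
    rw [← sum_mul]
    calc (∑ g ∈ Gs, (k g : ℝ)) * Real.log (Q / n) ≤ n * Real.log (Q / n) :=
          mul_le_mul_of_nonneg_right hn hlog0
      _ ≤ Q - n := mul_log_div_le hn0 (hn0.trans_le hQ)
  have h3 : ∑ g ∈ Gs, ((k g : ℝ) * Real.log (Q / n) + k g + c * k g * r g + n * Real.exp (-(c * r g))) =
      ∑ g ∈ Gs, (k g : ℝ) * Real.log (Q / n) + ∑ g ∈ Gs, (k g : ℝ) + c * ∑ g ∈ Gs, (k g : ℝ) * r g +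
        n * ∑ g ∈ Gs, Real.exp (-(c * r g)) := by
    rw [mul_sum, mul_sum, ← sum_add_distrib, ← sum_add_distrib, ← sum_add_distrib]
    refine sum_congr rfl fun g _ => ?_; ring
  linarith [h1, h2, h3]

/-! ## §3 The rank fibres: at most `ρ + 1` groups of rank `ρ` -/

/-- **THE RARE-GROUP SUM.**  If for every rank `ρ` at most `ρ + 1` groups have rank `ρ` (distinct (age, class) pairs of
the younger roots at one step), then `Σ_g e^{−c·r_g} ≤ 1∕(1 − e^{−c})²` for `c > 0`. [folklore] -/
theorem sum_exp_neg_rank_le {β : Type*} (Gs : Finset β) (r : β → ℕ) {c : ℝ} (hc : 0 < c)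
    (hfib : ∀ ρ : ℕ, (Gs.filter fun g => r g = ρ).card ≤ ρ + 1) :
    ∑ g ∈ Gs, Real.exp (-(c * r g)) ≤ 1 / (1 - Real.exp (-c)) ^ 2 := by
  classical
  set x := Real.exp (-c) with hxdef
  have hx0 : 0 ≤ x := (Real.exp_pos _).le
  have hx1 : x < 1 := by rw [hxdef]; exact Real.exp_lt_one_iff.2 (by linarith)
  have hnorm : ‖x‖ < 1 := by rwa [Real.norm_of_nonneg hx0]
  -- regroup by rank
  have hterm : ∀ g ∈ Gs, Real.exp (-(c * r g)) = x ^ r g := fun g _ => by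
    rw [hxdef, ← Real.exp_nat_mul]; ring_nf
  set R := Gs.image r with hR
  have hmaps : ∀ g ∈ Gs, r g ∈ R := fun g hg => mem_image_of_mem r hg
  rw [sum_congr rfl hterm, ← sum_fiberwise_of_maps_to hmaps]
  have hstep : ∀ ρ ∈ R, ∑ g ∈ Gs.filter (fun g => r g = ρ), x ^ r g ≤ ((ρ : ℝ) + 1) * x ^ ρ := by
    intro ρ _
    have : ∑ g ∈ Gs.filter (fun g => r g = ρ), x ^ r g = ((Gs.filter fun g => r g = ρ).card : ℝ) * x ^ ρ := by
      rw [sum_congr rfl fun g hg => by rw [(mem_filter.1 hg).2], sum_const, nsmul_eq_mul]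
    rw [this]
    exact mul_le_mul_of_nonneg_right (by exact_mod_cast hfib ρ) (pow_nonneg hx0 _)
  -- the full series `Σ (ρ+1) x^ρ = 1/(1−x)²`
  have hS1 : HasSum (fun ρ : ℕ => (ρ : ℝ) * x ^ ρ) (x / (1 - x) ^ 2) := hasSum_coe_mul_geometric_of_norm_lt_one hnorm
  have hS2 : HasSum (fun ρ : ℕ => x ^ ρ) (1 - x)⁻¹ := hasSum_geometric_of_lt_one hx0 hx1
  have hS : HasSum (fun ρ : ℕ => ((ρ : ℝ) + 1) * x ^ ρ) (x / (1 - x) ^ 2 + (1 - x)⁻¹) := by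
    convert hS1.add hS2 using 1; funext ρ; ring
  have hval : x / (1 - x) ^ 2 + (1 - x)⁻¹ = 1 / (1 - x) ^ 2 := by
    have h1x : (1 - x) ≠ 0 := by linarith
    field_simp; ring
  calc ∑ ρ ∈ R, ∑ g ∈ Gs.filter (fun g => r g = ρ), x ^ r g ≤ ∑ ρ ∈ R, ((ρ : ℝ) + 1) * x ^ ρ := sum_le_sum hstep
    _ ≤ x / (1 - x) ^ 2 + (1 - x)⁻¹ :=
        sum_le_hasSum R (fun ρ _ => mul_nonneg (by positivity) (pow_nonneg hx0 _)) hS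
    _ = 1 / (1 - x) ^ 2 := hval

/-! ## §4 Over the steps: the discounted crowding sums to the counts -/

/-- **THE DECAYED PAST IS PAID BY THE COUNTS**: `Σ_{t ≤ T} Q n σ t ≤ (Σ_{t ≤ T} n_t)∕(1 − σ²)` for `0 ≤ σ < 1`. [folklore] -/
theorem sum_Q_le (n : ℕ → ℕ) {σ : ℝ} (h0 : 0 ≤ σ) (h1 : σ < 1) (T : ℕ) :
    ∑ t ∈ range (T + 1), Q n σ t ≤ (∑ s ∈ range (T + 1), (n s : ℝ)) / (1 - σ ^ 2) := by
  have hs0 : 0 ≤ σ ^ 2 := sq_nonneg σ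
  have hs1 : σ ^ 2 < 1 := by nlinarith
  -- write the inner sum over `range (T+1)` with an indicator, then swap
  have hQ : ∀ t ∈ range (T + 1), Q n σ t =
      ∑ s ∈ range (T + 1), if s ≤ t then (n s : ℝ) * σ ^ (2 * (t - s)) else 0 := by
    intro t ht
    have hsub : range (t + 1) = (range (T + 1)).filter (fun s => s ≤ t) := by
      ext s; simp only [mem_range, mem_filter]; rw [mem_range] at ht; omega
    unfold Q
    rw [hsub, sum_filter]
  rw [sum_congr rfl hQ, sum_comm, sum_div]
  refine sum_le_sum fun s _ => ?_
  -- the inner geometric sum, re-indexed by `j = t − s`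
  have hinner : ∑ t ∈ range (T + 1), (if s ≤ t then (n s : ℝ) * σ ^ (2 * (t - s)) else 0) =
      (n s : ℝ) * ∑ t ∈ (range (T + 1)).filter (fun t => s ≤ t), (σ ^ 2) ^ (t - s) := by
    rw [mul_sum, sum_filter]
    refine sum_congr rfl fun t _ => ?_
    split_ifs <;> simp [pow_mul]
  have hinj : ∀ t ∈ (range (T + 1)).filter (fun t => s ≤ t), ∀ t' ∈ (range (T + 1)).filter (fun t => s ≤ t),
      t - s = t' - s → t = t' := by
    intro t ht t' ht' h
    simp only [mem_filter, mem_range] at ht ht'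
    omega
  have hgeom : ∑ t ∈ (range (T + 1)).filter (fun t => s ≤ t), (σ ^ 2) ^ (t - s) ≤ 1 / (1 - σ ^ 2) := by
    calc ∑ t ∈ (range (T + 1)).filter (fun t => s ≤ t), (σ ^ 2) ^ (t - s)
        = ∑ j ∈ ((range (T + 1)).filter (fun t => s ≤ t)).image (fun t => t - s), (σ ^ 2) ^ j := by
          rw [sum_image hinj]
      _ ≤ ∑ j ∈ range (T + 1), (σ ^ 2) ^ j := by
          refine sum_le_sum_of_subset_of_nonneg (fun j hj => ?_) fun _ _ _ => pow_nonneg hs0 _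
          obtain ⟨t, ht, rfl⟩ := mem_image.1 hj
          simp only [mem_filter, mem_range] at ht ⊢
          omega
      _ ≤ 1 / (1 - σ ^ 2) := geom_sum_le_inv hs0 hs1 (T + 1)
  rw [hinner, div_eq_mul_one_div]
  exact mul_le_mul_of_nonneg_left hgeom (Nat.cast_nonneg _)

/-- **OVER THE STEPS, SYMMETRISED, EXPONENT ONE.**  Steps `t ≤ T` with weighted counts `n t`, crowding `Q n σ t`,
sibling groups `Gs t` of sizes `k t g ≥ 1` with `Σ_g k t g ≤ n t` and ranks `r t g`, each step's rare-group sum bounded by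
`S` (e.g. `S = 1∕(1−e^{−c})²` by `sum_exp_neg_rank_le`), any rate `c`:
`Σ_t Σ_g (k·log Q_t − log k!) ≤ (1∕(1−σ²) + S)·Σ_t n_t + c·Σ_t Σ_g k·r`. [folklore] -/
theorem total_cost_le {β : Type*} (n : ℕ → ℕ) {σ : ℝ} (h0 : 0 ≤ σ) (h1 : σ < 1) (T : ℕ) (Gs : ℕ → Finset β)
    (k : ℕ → β → ℕ) (r : ℕ → β → ℝ) (c : ℝ) {S : ℝ} (hS : 0 ≤ S)
    (hk : ∀ t, ∀ g ∈ Gs t, 1 ≤ k t g) (hn : ∀ t, (∑ g ∈ Gs t, (k t g : ℝ)) ≤ n t) (hrare : ∀ t, ∑ g ∈ Gs t, Real.exp (-(c * r t g)) ≤ S) :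
    ∑ t ∈ range (T + 1), ∑ g ∈ Gs t, ((k t g : ℝ) * Real.log (Q n σ t) - Real.log (Nat.factorial (k t g) : ℝ)) ≤
      (1 / (1 - σ ^ 2) + S) * ∑ t ∈ range (T + 1), (n t : ℝ) +
        c * ∑ t ∈ range (T + 1), ∑ g ∈ Gs t, (k t g : ℝ) * r t g := by
  -- per step: either no group, or `step_cost_le` with `n = n t`, `Q = Q n σ t ≥ n t`
  have hstep : ∀ t ∈ range (T + 1),
      ∑ g ∈ Gs t, ((k t g : ℝ) * Real.log (Q n σ t) - Real.log (Nat.factorial (k t g) : ℝ)) ≤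
        Q n σ t + c * ∑ g ∈ Gs t, (k t g : ℝ) * r t g + (n t : ℝ) * S := by
    intro t _
    have hQ0 : 0 ≤ Q n σ t := sum_nonneg fun s _ => mul_nonneg (Nat.cast_nonneg _) (pow_nonneg h0 _)
    by_cases he : Gs t = ∅
    · simp only [he, sum_empty, mul_zero, add_zero]
      exact add_nonneg hQ0 (mul_nonneg (Nat.cast_nonneg _) hS)
    · obtain ⟨g₀, hg₀⟩ := nonempty_iff_ne_empty.2 he
      have hn0 : (0 : ℝ) < n t := by
        have h1' : (1 : ℝ) ≤ k t g₀ := by exact_mod_cast hk t g₀ hg₀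
        have := (single_le_sum (fun g _ => (Nat.cast_nonneg (k t g) : (0 : ℝ) ≤ k t g)) hg₀).trans (hn t)
        linarith
      have hmain := step_cost_le (Gs t) (k t) (r t) c (hk t) (hn t) hn0 (self_le_Q n h0 t)
      have hkn : ∑ g ∈ Gs t, (k t g : ℝ) ≤ n t := hn t
      have hrr : (n t : ℝ) * ∑ g ∈ Gs t, Real.exp (-(c * r t g)) ≤ (n t : ℝ) * S :=
        mul_le_mul_of_nonneg_left (hrare t) (Nat.cast_nonneg _)
      linarith
  have hsumQ := sum_Q_le n h0 h1 T
  calc ∑ t ∈ range (T + 1), ∑ g ∈ Gs t, ((k t g : ℝ) * Real.log (Q n σ t) - Real.log (Nat.factorial (k t g) : ℝ))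
      ≤ ∑ t ∈ range (T + 1), (Q n σ t + c * ∑ g ∈ Gs t, (k t g : ℝ) * r t g + (n t : ℝ) * S) := sum_le_sum hstep
    _ = ∑ t ∈ range (T + 1), Q n σ t + c * ∑ t ∈ range (T + 1), ∑ g ∈ Gs t, (k t g : ℝ) * r t g +
          S * ∑ t ∈ range (T + 1), (n t : ℝ) := by
        rw [sum_add_distrib, sum_add_distrib, mul_sum, mul_sum]
        refine congrArg₂ _ (congrArg₂ _ rfl rfl) (sum_congr rfl fun t _ => by ring)
    _ ≤ (∑ t ∈ range (T + 1), (n t : ℝ)) / (1 - σ ^ 2) + c * ∑ t ∈ range (T + 1), ∑ g ∈ Gs t, (k t g : ℝ) * r t g +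
          S * ∑ t ∈ range (T + 1), (n t : ℝ) := by linarith
    _ = (1 / (1 - σ ^ 2) + S) * ∑ t ∈ range (T + 1), (n t : ℝ) +
          c * ∑ t ∈ range (T + 1), ∑ g ∈ Gs t, (k t g : ℝ) * r t g := by ring

/-! ## §5 Sanity: the equal-sibling crowd of F-leaf05-2 ∕ F-leaf10-1 -/

namespace Sanity

/-- ONE group of `k` equal siblings at a step with `n = Q = k` (the crowd itself, no past): the symmetrised cost is
at most `2k + n·e^{−c r}` — LINEAR in `k`, where the unsymmetrised `k·log k` is not. [folklore] -/
example {k : ℕ} (hk : 1 ≤ k) (c r : ℝ) :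
    (k : ℝ) * Real.log k - Real.log (Nat.factorial k : ℝ) ≤ (k : ℝ) + c * k * r + k * Real.exp (-(c * r)) := by
  have h := group_cost_le hk c r (le_refl (k : ℝ)) (le_refl (k : ℝ))
  have hk0 : (0 : ℝ) < k := by exact_mod_cast hk
  rw [div_self hk0.ne', Real.log_one, mul_zero, zero_add] at h
  exact h

end Sanity

end

end Summit.QuantumFields.BalabanUV.T4Continuum.HistorySiblingMass
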